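import Mathlib
import Summits.ValiantsHypothesis.ValiantsHypothesis.Theses.NewtonUnitEquations
import Summits.ValiantsHypothesis.ValiantsHypothesis.Theorems.NewtonUnitEquationsDissociatedUniformQuasiPoly

/-!
# Sketch (crux-strategist, stmt-ValiantsHypothesis-5904): the ADMISSIBLE RETARGET — weaker crux-side targets that still
# feed the deciding theorem, and the re-glued `closes`

Idea card `Ideas/admissible-retarget.md`.  Everything here elaborates; the two transfer statements are `def`s (their
proofs = the tree's `KPTT.theorem1_holds` re-run with `k` padded to `≥ 2^m`, resp. with a `√n·log² n < n` final inequality)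
and `closes_log` / `closes_quasi` show that the route's deciding theorem re-glues to either target verbatim.
-/

set_option linter.dupNamespace false

namespace Summit.ValiantsHypothesis.ValiantsHypothesis.Cruxes.NewtonTauWeak.AdmissibleRetarget

open scoped BigOperators
open Summit.ValiantsHypothesis.ValiantsHypothesis.Theses.NewtonUnitEquations (NewtonTauWeak KpttTransfer)
open Literature.Computability.AlgebraicComplexity (IsVPFamily perPoly)

/-- R1 = route item `LogFactorBound` (stmt-ValiantsHypothesis-16048), verbatim. -/
def LogFactorBound : Prop :=
  ∃ b : ℕ, ∀ (k m t : ℕ) (f : Fin k → Fin m → MvPolynomial (Fin 2) ℂ), m ≤ Nat.log 2 k →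
    (∀ i j, (f i j).support.card ≤ t) →
      (Set.extremePoints ℝ (convexHull ℝ ((fun e : Fin 2 →₀ ℕ => fun i : Fin 2 => ((e i : ℕ) : ℝ)) ''
        ((∑ i, ∏ j, f i j).support : Set (Fin 2 →₀ ℕ))))).ncard ≤ (k * t + 2) ^ b

/-- The QUASI target (Theorem-Q shape): `vert ≤ 2^{a m} (k t + 2)^{b ⌈log₂ (m+2)⌉}`.  Implied by the crux; its dissociated
case is the landed `dissociated_quasiPoly`; it satisfies KPTT's printed Thm 1 hypothesis `2^{(m + log kt)^c}`, `c < 2`. -/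
def NewtonTauQuasi : Prop :=
  ∃ a b : ℕ, ∀ (k m t : ℕ) (f : Fin k → Fin m → MvPolynomial (Fin 2) ℂ),
    (∀ i j, (f i j).support.card ≤ t) →
      (Set.extremePoints ℝ (convexHull ℝ ((fun e : Fin 2 →₀ ℕ => fun i : Fin 2 => ((e i : ℕ) : ℝ)) ''
        ((∑ i, ∏ j, f i j).support : Set (Fin 2 →₀ ℕ))))).ncard ≤ 2 ^ (a * m) * (k * t + 2) ^ (b * Nat.clog 2 (m + 2))

/-- Transfer item for R1 (to be proved by re-running `KPTT.theorem1_holds` with zero-padding of `k` to `2^m`). -/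
def KpttTransferLog : Prop := LogFactorBound → ¬ IsVPFamily (fun n => perPoly (Fin n) ℂ)

/-- Transfer item for the quasi target (KPTT Thm 1 as printed, `c < 2`; final inequality `O(√n log² n) < n`). -/
def KpttTransferQuasi : Prop := NewtonTauQuasi → ¬ IsVPFamily (fun n => perPoly (Fin n) ℂ)

/-- The crux implies the quasi target (`⌈log₂(m+2)⌉ ≥ 1`). -/
theorem newtonTauQuasi_of_newtonTauWeak (h : NewtonTauWeak) : NewtonTauQuasi := by
  obtain ⟨a, b, h⟩ := h
  refine ⟨a, b, fun k m t f hf => (h k m t f hf).trans ?_⟩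
  refine Nat.mul_le_mul_left _ (Nat.pow_le_pow_right (by omega) ?_)
  have : 1 ≤ Nat.clog 2 (m + 2) := Nat.clog_pos one_lt_two (by omega)
  calc b = b * 1 := (mul_one b).symm
    _ ≤ b * Nat.clog 2 (m + 2) := Nat.mul_le_mul_left b this

/-- RE-GLUED DECIDING THEOREM on R1: same proof as the route's `closes`, with `LogFactorBound` + `KpttTransferLog` in place of
`NewtonTauWeak` + `KpttTransfer`. -/
theorem closes_log (h : LogFactorBound) (h' : KpttTransferLog) : _root_.ValiantsHypothesis := by
  show Literature.Computability.AlgebraicComplexity.VP ℂ ≠ Literature.Computability.AlgebraicComplexity.VNP ℂ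
  intro hEq
  have hVNP := Literature.Computability.AlgebraicComplexity.perFamily_mem_VNP_holds ℂ
  have hVP : Literature.Computability.AlgebraicComplexity.perFamily ℂ ∈
      Literature.Computability.AlgebraicComplexity.VP ℂ := by
    rw [hEq]; exact hVNP
  exact h' h ((Literature.Computability.AlgebraicComplexity.mem_VP_ofFintype_iff_holds _).1 hVP)

/-- RE-GLUED DECIDING THEOREM on the quasi target. -/
theorem closes_quasi (h : NewtonTauQuasi) (h' : KpttTransferQuasi) : _root_.ValiantsHypothesis := by
  show Literature.Computability.AlgebraicComplexity.VP ℂ ≠ Literature.Computability.AlgebraicComplexity.VNP ℂ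
  intro hEq
  have hVNP := Literature.Computability.AlgebraicComplexity.perFamily_mem_VNP_holds ℂ
  have hVP : Literature.Computability.AlgebraicComplexity.perFamily ℂ ∈
      Literature.Computability.AlgebraicComplexity.VP ℂ := by
    rw [hEq]; exact hVNP
  exact h' h ((Literature.Computability.AlgebraicComplexity.mem_VP_ofFintype_iff_holds _).1 hVP)

/-- What is already KNOWN toward the quasi target: its dissociated case, uniformly in `k` (tree Theorem Q). -/
example := @Summit.ValiantsHypothesis.ValiantsHypothesis.Theorems.NewtonUnitEquationsDissociatedUniform.dissociated_quasiPoly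

end Summit.ValiantsHypothesis.ValiantsHypothesis.Cruxes.NewtonTauWeak.AdmissibleRetarget
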